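import Literature.NumberTheory.EllipticCurves.BurungaleKobayashiOta2024.SupersingularPConverse
import Literature.NumberTheory.EllipticCurves.BSDAnalyticRankTunnellCMProofs
import Literature.NumberTheory.EllipticCurves.CongruentNumberCurveSupersingular
import Literature.NumberTheory.EllipticCurves.LiLiuTian2024.CongruentNumberFullBSD

/-! # Route `CongruentShaFreeCut` (rung S2) — registered stub `stub_rung_supersingular` of crux
`AnalyticRankOneOfRankOneFiniteShaTwo` (stmt-BirchSwinnertonDyer-19080): the BC5 rung in the sibling
supersingular setting

The crux is the Ш-finite 2-converse `rank E_n(ℚ) = 1 ∧ #Ш(E_n/ℚ)[2^∞] < ∞ ⟹ ord_{s=1} L(E_n,s) = 1`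
at the RAMIFIED CM prime `2` of `E_n : y² = x³ − n²x`. Its sibling-setting analogue at a good
SUPERSINGULAR prime `p ≥ 5` of the SAME curves (`p ≡ 3 (mod 4)`, `p ∤ n`: `a_p(E_n) = 0`, `p` inert in
`ℚ(i)`) is decided in print — Burungale–Kobayashi–Ota, JIMJ 23 (2024) Thm. 1.5, tree fact
`BurungaleKobayashiOta2024.thm15_analyticRank_eq_one_of_selmerCorank_eq_one` — by exactly the route's
lever (Rubin-type formula + explicit reciprocity law + Gross–Zagier at a non-split prime), while the
rung-leaf's analogue there (`corank_{ℤ_p} Sel_{p^∞}(E_n) = 1 ⟹ ord = 1` at inert `p`, the refined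
converse (1.6)) is OPEN (loc. cit. Rem. 1.6 (ii)). This file specialises the tree theorem
`BurungaleKobayashiOta2024.analyticRank_eq_one_of_mordellWeilRank_eq_one_of_finite_sha_primary` to `E_n`;
the theorem is named and typed EXACTLY as the stub registered on the item (skeleton sha d981ef2b334c),
so it lands with `--supports stmt-BirchSwinnertonDyer-19080`. It does not close the item (the leaf's
prime `2` is ramified/additive, outside BKO's inert regime). -/

namespace Summit.BirchSwinnertonDyer.BirchSwinnertonDyer.Theorems.CongruentShaFreeCutRungSupersingular

open Literature.NumberTheory.EllipticCurves WeierstrassCurve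

/-- **Rung (BC5) for `AnalyticRankOneOfRankOneFiniteShaTwo`**: the crux with the ramified prime `2`
replaced by any good supersingular prime `p ≥ 5` (`p ≡ 3 (mod 4)`, `p ∤ n`) of the congruent number
curve `E_n`, `n` squarefree, granted BKO 2024 Thm. 1.5 as printed (`hBKO`). -/
theorem stub_rung_supersingular
    (hBKO : BurungaleKobayashiOta2024.thm15_analyticRank_eq_one_of_selmerCorank_eq_one)
    {n : ℕ} (hn : Squarefree n) {p : ℕ} [Fact p.Prime] (hp : 5 ≤ p) (hp4 : p % 4 = 3)
    (hpn : ¬ p ∣ n) (hrank : (congruentNumberCurve n).mordellWeilRank = 1)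
    (hsha : Finite (AddCommGroup.primaryComponent (congruentNumberCurve n).sha p)) :
    (congruentNumberCurve n).analyticRank = 1 := by
  have hpP : p.Prime := Fact.out
  haveI := isElliptic_congruentNumberCurve hn.ne_zero
  haveI := isGloballyMinimal_congruentNumberCurve hn
  have hp2n : ¬ p ∣ 2 * n := by
    intro h
    rcases hpP.dvd_mul.1 h with h2 | h2
    · have := Nat.le_of_dvd two_pos h2
      omega
    · exact hpn h2
  have hgood : (congruentNumberCurve n).HasGoodReductionAtPrime p :=
    hasGoodReductionAtPrime_congruentNumberCurve hp2n
  have hss : (p : ℤ) ∣ (congruentNumberCurve n).frobeniusTrace p := by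
    rw [frobeniusTrace_congruentNumberCurve, frobeniusTrace_congruentNumberCurveInt hpP hp4 hpn]
    exact dvd_zero _
  exact BurungaleKobayashiOta2024.analyticRank_eq_one_of_mordellWeilRank_eq_one_of_finite_sha_primary
    hBKO _ (LiLiuTian2024.hasCM_congruentNumberCurve n) p hp hgood hss hrank hsha

end Summit.BirchSwinnertonDyer.BirchSwinnertonDyer.Theorems.CongruentShaFreeCutRungSupersingular
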